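/-
COR-CM (cell pub-hodgecm2) — HM-EQUALITY Δ2 ∕ X3, row X3-Char item (F) at the PIN, the `hbad` slot of the VERSION-B END file
(`CorCM/PortJoin/ClosedPrinted.lean` §A ∕ `D2Bridge/PinSignatures.thm418C_liuDictionaryPin_of_pins` at `Good i := Continuous i.2.1`):
the `μ`-block of the pinned Liu dictionary over the index lines `LiuIndex.line V ρ μ` VANISHES at every index whose pair splitting is
NOT CONTINUOUS.  Seat `prover-pub-hodgecm2-pin-3-g12-0` (pin-3 gen 12; X3-Char owner), 2026-08-23.  Theorems only: no definition, no
instance, no named fact, no proof hole; nothing landed is edited or restated — the file COMPOSES own-htheta's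
`BlockVanishing.block_pin_lineOf_eq_bot_of_not_smooth` (✔ `Item6PinBlockVanishing`) with pin-3's
`CentralTypeAtPin.continuous_of_hasCentralTypeAt_of_smooth` (`Item6CentralTypeAtPinSmooth`).  FRAMING: HC_CM is NOT proved; no COR-CM
binder is discharged here; «Δ2 BRIDGE CLOSED» is NOT claimed; the cite `h418` is NOT discharged here.
-/
import Summits.HodgeConjecture.CorCM.B01.Transposition.Item6PinBlockVanishing
import Summits.HodgeConjecture.CorCM.B01.Transposition.Item6CentralTypeAtPinSmooth
import Summits.HodgeConjecture.HodgeCM.Model.LiuIndexCentralType_1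
import Literature.NumberTheory.GelbartRogawski1991.UnitaryDualPairThetaKernelCMKTypeFin
import HarnessLib

/-!
# The pinned dictionary over `LiuIndex.line V ρ μ`: `block i = ⊥` at every index with NON-CONTINUOUS pair splitting

For a hermitian 3-space `V`, a section `ρ : GramClass L → RealScalar L` of the Gram classes and a central-type recipe
`μ : GramClass L → (InfinitePlace L → ℤ)`, the index type `LiuIndex.I V ρ μ = IOf V ρ (CentralTypeIs V μ)` enumerates the compatible
pair splittings `s` of the CM pair datum at the scalar `ρ q` HAVING THE CENTRAL TYPE `μ q` (port layer 69), and
`LiuIndex.line V ρ μ i = lineOf … i = SplitLineE.ofCM V e₁ (vec (ρ i.1)) … i.2.1 …` is its line.  Two tree theorems compose: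

* own-htheta, `Item6PinBlockVanishing.block_pin_lineOf_eq_bot_of_not_smooth`: at an index whose finite Weil representation
  (`U(V)`-member through the frame transport `ιVE V`, and `U(W)`-member) is NOT smooth, the `μ`-block of
  `liuDictionaryPin … V (IOf V ρ P) (lineOf V ρ P)` is `⊥` ([GR91, Prop. 3.1.1] discharged at the vendored CM splitting datum);
* pin-3, `Item6CentralTypeAtPinSmooth.continuous_of_hasCentralTypeAt_of_smooth`: a compatible pair splitting with SMOOTH finite Weil
  representation (through any continuous OPEN `ι`, here `ιVE V`, open by `isOpenMap_finPart_cmKTypeHom_finAdelicToAdelic`) and a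
  central type is CONTINUOUS.

Hence **`block_pin_line_eq_bot_of_not_continuous`**: `¬ Continuous i.2.1 → (liuDictionaryPin … V (I V ρ μ) (line V ρ μ)).block i = ⊥`,
and **`block_pin_line_eq_bot_of_not_continuous'`**: the same in the binder shape
`∀ i, SplitLine.PhiMuLine ι₁ (line V ρ μ i) → ¬ Continuous (i.2.1 : SplittingAt V (ρ i.1)) → … .block i = ⊥` of the END file's `hbad`
(`Good i := Continuous i.2.1`), which at `ρ := repAt a₀`, `μ := muLiu ι₁ GramClass.rep` and the record rows is that binder BY VALUE.

References: S. Gelbart, J. Rogawski, *L-functions and Fourier–Jacobi coefficients for the unitary group U(3)*, Invent. Math. 105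
(1991), §3.1 Prop. 3.1.1 (p. 455), Remark p. 457; I. N. Bernstein, A. V. Zelevinsky, *Russian Math. Surveys* 31 (1976), §2.1;
A. Weil, *Acta Math.* 111 (1964), n° 39.
-/

set_option autoImplicit false

noncomputable section

namespace Summit.HodgeConjecture.CorCM.Transposition.BlockVanishing

open NumberField
open Literature.AlgebraicGeometry.HodgeTheory Literature.NumberTheory.Automorphic.PicardCM
open Literature.NumberTheory.GelbartRogawski1991
open Literature.NumberTheory.Transcendental (Arapura2012_Cor_15_4_6)
open HodgeCM HodgeCM.Model HodgeCM.Model.LiuIndex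

variable {L : CMField} {ι₁ : (L : Type) →+* ℂ}

/-- **`block i = ⊥` at every index `i : LiuIndex.I V ρ μ` whose pair splitting `i.2.1` is NOT CONTINUOUS**, for the pinned Liu
dictionary over the index lines `LiuIndex.line V ρ μ`: a non-continuous index splitting has NON-smooth finite Weil representation
(it is compatible and has a central type, so smooth would force continuous — pin-3 `continuous_of_hasCentralTypeAt_of_smooth` at the
open frame transport `ιVE V`), and at a non-smooth index line the block vanishes (own-htheta `block_pin_lineOf_eq_bot_of_not_smooth`).
[cite: GelbartRogawski1991, §3.1 Prop. 3.1.1 p. 455 L1–3, Remark p. 457 L4–13] [cite: BernsteinZelevinsky1976, §2.1]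
[cite: Weil1964, Chap. III n° 39 p. 189] -/
theorem block_pin_line_eq_bot_of_not_continuous (hHD : exists_isReal_hodgeModel) (hI : hodgePQ_independent_of_hodgeModel)
    (h₁ : BallQuotientUniformised) (h₃ : CMAbelianVarietyRealised) (hA : Arapura2012_Cor_15_4_6)
    (V : HermSpace3 L ι₁) (ρ : GramClass L → RealScalar L) (μ : GramClass L → InfinitePlace (L : Type) → ℤ)
    (i : I V ρ μ) (hnc : ¬ Continuous (i.2.1 : SplittingAt V (ρ i.1))) :
    (liuDictionaryPin hHD hI h₁ h₃ hA V (I V ρ μ) (line V ρ μ)).block i = ⊥ :=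
  block_pin_lineOf_eq_bot_of_not_smooth hHD hI h₁ h₃ hA V ρ (CentralTypeIs V μ) i fun hsm =>
    hnc (CentralTypeAtPin.continuous_of_hasCentralTypeAt_of_smooth V (ρ i.1) i.2.1 (isCompatAt_of_mem V ρ μ i)
      (hasCentralTypeAt_of_mem V ρ μ i) (ιVE V) (continuous_ιVE V)
      (UnitaryDualPair.isOpenMap_finPart_cmKTypeHom_finAdelicToAdelic (L : Type) V.Hm (frameG V) (frameD V) (frame_congr V))
      hsm.1 hsm.2)

/-- **The END file's `hbad` binder BY VALUE** (VERSION-B, `Good i := Continuous i.2.1`): for every index `i : LiuIndex.I V ρ μ` (the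
line's `Φ_μ`-membership hypothesis is carried, unused) whose pair splitting is NOT continuous, the `μ`-block of
`liuDictionaryPin … V (I V ρ μ) (line V ρ μ)` is `⊥`.  At `ρ := repAt a₀`, `μ := muLiu ι₁ GramClass.rep` and the record rows this is
LITERALLY the `hbad` hypothesis of `PortJoin/ClosedPrinted.lean` §A ∕ of `PinSignatures.thm418C_liuDictionaryPin_of_pins`.
[cite: GelbartRogawski1991, §3.1 Prop. 3.1.1 p. 455 L1–3, Remark p. 457 L4–13] [cite: BernsteinZelevinsky1976, §2.1]
[cite: Weil1964, Chap. III n° 39 p. 189] -/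
theorem block_pin_line_eq_bot_of_not_continuous' {hHD : exists_isReal_hodgeModel} {hI : hodgePQ_independent_of_hodgeModel}
    {h₁ : BallQuotientUniformised} {h₃ : CMAbelianVarietyRealised} {hA : Arapura2012_Cor_15_4_6}
    (V : HermSpace3 L ι₁) (ρ : GramClass L → RealScalar L) (μ : GramClass L → InfinitePlace (L : Type) → ℤ) :
    ∀ i : I V ρ μ, SplitLine.PhiMuLine ι₁ (line V ρ μ i) → ¬ Continuous (i.2.1 : SplittingAt V (ρ i.1)) →
      (liuDictionaryPin hHD hI h₁ h₃ hA V (I V ρ μ) (line V ρ μ)).block i = ⊥ :=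
  fun i _ hnc => block_pin_line_eq_bot_of_not_continuous hHD hI h₁ h₃ hA V ρ μ i hnc

end Summit.HodgeConjecture.CorCM.Transposition.BlockVanishing

end
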